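import Mathlib
import HarnessLib
import Summits.NavierStokesRegularity.NavierStokesRegularity.Theses.UnthreadedRigidityDoor
import Summits.NavierStokesRegularity.NavierStokesRegularity.Theorems.UnthreadedRigidityDoorUnthreadedRigidityVirialHornCompositions
import Summits.NavierStokesRegularity.NavierStokesRegularity.Theorems.UnthreadedRigidityDoorUnthreadedRigidityVirialHornAngularTwo
import Summits.NavierStokesRegularity.NavierStokesRegularity.Theorems.UnthreadedRigidityDoorUnthreadedRigidityVirialHornWindowAxisUniform

/-!
# Route `UnthreadedRigidityDoor`, item `UnthreadedRigidity` (W2, stmt-NavierStokesRegularity-27585) — LINE g11-1 «VIRIAL HORN»: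
# the window rung with S-U discharged, degree by degree, and the crux reduced to slicewise axisymmetry

Bookkeeping on top of the landed S-U `windowAxisUniform_holds` (p701191), S-A/S-V/S-Z (`isotypicWindowRigidityL_of_bridges`,
p697225) and S-C in degrees `1, 2` (`angularLemma_one`, `angularLemma_two`, p700578):

* `isotypicWindowRigidityL_of_bridges_at` — COMPOSITION W with EVERY support discharged except the ANGULAR LEMMA AT THE ONE DEGREE `l`
  (hypothesis `∀ Y, IsSolidHarmonic l Y → 𝒜(Y) ≡ 0 → IsZonal Y`, weaker than the all-degree `AngularLemma`): the window rung
  `IsotypicWindowRigidityL l n` follows from the two bridges W `WindowWedgeAnalyticL`, V-W `VirialWindowSilence` and that degree-`l` lemma;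
* `isotypicWindowRigidity_one_of_bridges`, `isotypicWindowRigidity_two_of_bridges'` — degrees `1` and `2`: the window rung waits ONLY on
  the two M–L bridges (S-C is a tree theorem there);
* `isotypicWindowRigidityL_of_bridges'` — all degrees: bridges + the all-degree `AngularLemma` (S-U discharged);
* `unthreadedRigidity_of_slicewise` — the crux `UnthreadedRigidity` (27585) BY NAME follows from its SLICEWISE form «every slice of an
  unthreaded window is axisymmetric about some axis through `x₀`»: the «ONE fixed axis» clause of the crux is free (S-U).

HONEST LABEL: plumbing of one RUNG line; the bridges W, V-W (M–L) and S-C in degrees `≥ 3` remain; `UnthreadedRigidity` (27585), W2 and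
NS regularity remain OPEN; nothing here is a statement about regularity of Navier–Stokes solutions.  `--supports stmt-NavierStokesRegularity-27585`
(helper); ns-crc-p2 g8.  [cite: KochNadirashviliSereginSverak2009, §4; MajdaBertozziCUP2002, §1.2 Prop. 1.1 (iii)]
-/

-- the summit and its single sub-problem share the name (CONVENTIONS §1)
set_option linter.dupNamespace false

namespace Summit.NavierStokesRegularity.NavierStokesRegularity.Theorems.UnthreadedRigidity.VirialHorn

open scoped Topology
open Filter Set
open Summit.NavierStokesRegularity.NavierStokesRegularity.Theorems.UnthreadedRigidity.ProfileHorn (E3 IsSliceAxisymmetric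
  isSliceAxisymmetric_of_eq_zero)

/-- COMPOSITION W with S-A, S-V, S-Z, S-U discharged and the angular lemma needed ONLY at the degree `l` of the rung: the bridges
W `WindowWedgeAnalyticL`, V-W `VirialWindowSilence` and «solid harmonics of degree `l` with `{Y,|∇Y|²} ≡ 0` are zonal» give
`IsotypicWindowRigidityL l n`. -/
theorem isotypicWindowRigidityL_of_bridges_at (l n : ℕ) (hl : 1 ≤ l) (hWA : WindowWedgeAnalyticL) (hVW : VirialWindowSilence)
    (hC : ∀ Y : E3 → ℝ, IsSolidHarmonic l Y → (∀ y : E3, angForm Y y = 0) → IsZonal Y) :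
    IsotypicWindowRigidityL l n := by
  intro S hS hconn u x₀ hcont hdiv hmild hbdd hunth hiso
  obtain ⟨B, cf, hB, hslice⟩ := hiso
  have hsep : ∀ t ∈ S, ∃ (H : ℝ → ℝ) (Y : E3 → ℝ),
      VirialAdmissible l H ∧ IsSolidHarmonic l Y ∧ u t = sepShellL H Y x₀ := by
    intro t ht
    obtain ⟨hW, hA⟩ := hWA l n S hl hS u x₀ hcont hdiv hmild hbdd hunth B cf hB hslice t ht
    obtain ⟨H, Y, hH, hY, hHY⟩ := analyticWedgeSeparableL_holds l n (cf t) B x₀ (hslice t ht).1 hA hW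
    refine ⟨H, Y, hH, hY, ?_⟩
    rw [(hslice t ht).2]
    exact hHY
  choose! Hf Yf hHa hYh hHu using hsep
  have key := hVW l S hl hS u x₀ hcont hdiv hmild hbdd hunth Hf Yf (fun t ht => ⟨hHa t ht, hYh t ht, hHu t ht⟩)
  have hax : ∀ t ∈ S, IsSliceAxisymmetric (u t) x₀ := by
    intro t ht
    by_cases hm : virialMoment l (Hf t) = 0
    · have hH0 : ∀ r : ℝ, 0 ≤ r → Hf t r = 0 := virialNondegeneracy_holds l (Hf t) hl (hHa t ht) hm
      apply isSliceAxisymmetric_of_eq_zero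
      intro x
      rw [hHu t ht]
      exact sepShellL_null (Hf t) (Yf t) x₀ hH0 x
    · have hA : ∀ ξ : E3, angForm (Yf t) ξ = 0 := fun ξ =>
        (mul_eq_zero.mp (key t ht ξ)).resolve_left hm
      rw [hHu t ht]
      exact zonalShellAxisym_holds l (Hf t) (Yf t) x₀ (hYh t ht) (hC (Yf t) (hYh t ht) hA) (hHa t ht)
  exact windowAxisUniform_holds S hS hconn u x₀ hcont hdiv hmild hbdd hax

/-- DEGREE ONE: the isotypic window rung `IsotypicWindowRigidityL 1 n` waits only on the two bridges W and V-W (every degree-one solid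
harmonic is zonal, `angularLemma_one`). -/
theorem isotypicWindowRigidity_one_of_bridges (n : ℕ) (hWA : WindowWedgeAnalyticL) (hVW : VirialWindowSilence) :
    IsotypicWindowRigidityL 1 n :=
  isotypicWindowRigidityL_of_bridges_at 1 n le_rfl hWA hVW fun Y hY _ => angularLemma_one Y hY

/-- DEGREE TWO: the isotypic window rung `IsotypicWindowRigidityL 2 n` waits only on the two bridges W and V-W (S-C at `l = 2` is the
tree theorem `angularLemma_two`, S-U is `windowAxisUniform_holds`). -/
theorem isotypicWindowRigidity_two_of_bridges' (n : ℕ) (hWA : WindowWedgeAnalyticL) (hVW : VirialWindowSilence) :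
    IsotypicWindowRigidityL 2 n :=
  isotypicWindowRigidityL_of_bridges_at 2 n (by norm_num) hWA hVW fun Y hY hA => angularLemma_two Y hY hA

/-- ALL DEGREES: COMPOSITION W with S-A, S-V, S-Z AND S-U discharged — the bridges W, V-W and the all-degree ANGULAR LEMMA S-C give the
window rung in every degree `l ≥ 1`. -/
theorem isotypicWindowRigidityL_of_bridges' (l n : ℕ) (hl : 1 ≤ l) (hWA : WindowWedgeAnalyticL) (hVW : VirialWindowSilence)
    (hC : AngularLemma) : IsotypicWindowRigidityL l n :=
  isotypicWindowRigidityL_of_bridges l n hl hWA hVW hC windowAxisUniform_holds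

/-- THE CRUX REDUCED TO ITS SLICEWISE FORM (kernel-checked, by name): if every slice of every unthreaded window (the hypotheses of
`UnthreadedRigidity` VERBATIM) is axisymmetric about SOME axis through `x₀`, then `UnthreadedRigidity` (stmt-27585) holds — the common
axis is supplied by S-U `windowAxisUniform_holds`.  (A reduction, not a proof: the slicewise statement is the whole difficulty.) -/
theorem unthreadedRigidity_of_slicewise
    (h : ∀ (S : Set ℝ), IsOpen S → IsPreconnected S → ∀ (u : ℝ → E3 → E3) (x₀ : E3),
      ContinuousOn (Function.uncurry u) (S ×ˢ Set.univ) →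
      (∀ t ∈ S, Literature.Analysis.FluidPDE.VectorCalculus.IsDivFree (u t)) →
      (∀ s ∈ S, ∀ t ∈ S, s < t → ∀ x, u t x =
          Literature.Analysis.UnboundedOperators.heatExtension (u s) (t - s) x
            - Literature.Analysis.FluidPDE.oseenDuhamel 1 s u u t x) →
      (∀ τ ∈ S, ∃ B : ℝ, ∀ t ∈ S, t ≤ τ → ∀ x, ‖u t x‖ ≤ B) →
      (∀ t ∈ S, ∀ x, inner ℝ (Literature.Analysis.FluidPDE.curl (u t) x) (x - x₀) = 0) →
      ∀ t ∈ S, IsSliceAxisymmetric (u t) x₀) :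
    Summit.NavierStokesRegularity.NavierStokesRegularity.Theses.UnthreadedRigidityDoor.UnthreadedRigidity := by
  intro S hS hconn u x₀ hcont hdiv hmild hbdd hunth
  exact windowAxisUniform_holds S hS hconn u x₀ hcont hdiv hmild hbdd
    (h S hS hconn u x₀ hcont hdiv hmild hbdd hunth)

end Summit.NavierStokesRegularity.NavierStokesRegularity.Theorems.UnthreadedRigidity.VirialHorn
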